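import Summits.BirchSwinnertonDyer.Rank1Residual.Partition.EisensteinKernelInertiaLineMult
import Summits.BirchSwinnertonDyer.Rank1Residual.Partition.EisensteinKernelTypeGoodOrdinary
import HarnessLib

/-!
# Ramification of a rational `p`-line at a MULTIPLICATIVE odd `p`: `Φ` is ramified at `p` iff it is
# the inertia line iff the abscissa of its points is not `𝔓`-integral — without the Tate curve

HONEST FRAMING (cell `b2b-bsdres-*`, verbatim): the goal of the cell is to DELETE the
COMBINATION-SHAPED residual classes for ALL analytic-rank ≤ 1 curves over ℚ — "full BSD formula
for every rank ≤ 1 curve in class C" assembled STRICTLY from published theorems — so that the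
rank-≤1 remainder becomes exactly the CONSTRUCTION-SHAPED classes, which are TYPED (missing-input
Props), NOT attempted; this is not "finishing BSD". Off-peak literature typer `b2b-bsdres-lit-cgls`
(CGLS22 / GV00, the reducible = Eisenstein column), session 15, file 2 of 3: an ELEMENTARY REDUCTION
of the Eisenstein column at every MULTIPLICATIVE odd prime (class X2 / the O9, N9 sub-cells) —
theorems only, no definition, no named fact, nothing booked, no label changed.

WHY. The second half of the lane's decision procedure of record for `GVPar W p` (bsdN/HYPOTHESES.md row
T-GV0: "ramified ⇔ `H` not `p`-integral (`Φ` = kernel of reduction on the minimal model)") as a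
theorem at every MULTIPLICATIVE odd `p` of a globally minimal `E/ℚ`, for every rational `p`-line `Φ`
and any non-zero `P = (x, y) ∈ Φ` — the twin of session 14's good-ordinary
`lineUnramifiedAt_iff_valuation_le_one`, and the theory-level validation of the KDISC-ODD engine's
ramification bit on the multiplicative O9 / N9 rows (HOME/class-closure/O9/KDISC-ODD-typer6.md). The
forward half ("unramified ⇒ integral") is unit `eisenstein-p2`'s
`X2.UnramifiedLineIntegral.valuation_le_one_of_lineUnramifiedAt_of_mult`; the converse uses file 1's
Tate-free inertia line (`exists_inertiaLine_of_mult`: order `p`, `(σ - 1)E[p] ⊆ L`, moved by inertia,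
contained in the kernel of reduction) and x1a's `eq_of_not_lineUnramifiedAt` (a ramified rational line
IS the (hL) line). No Tate uniformisation (`hT`, `hT'` not used).

* §3 `lineUnramifiedAt_of_valuation_le_one_of_mult` (one `𝔓`-integral non-zero point ⇒ unramified),
  **`lineUnramifiedAt_iff_valuation_le_one_of_mult`**, `not_lineUnramifiedAt_iff_one_lt_valuation_of_mult`,
  `not_lineUnramifiedAt_iff_forall_smul_sub_mem_of_mult` (ramified ⇔ `(σ - 1)E[p] ⊆ Φ` at a prime
  above `p` ⇔ `Φ` is the canonical subgroup), `valuation_le_one_iff_of_mem_of_mult` (independence of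
  the point), and the certificate shapes of session 14 at a multiplicative prime:
  `lineUnramifiedAt_of_isIntegral_of_mult` (`x·d` integral over `ℤ`, `p ∤ d` — a `p`-integral monic
  kernel polynomial, the shape of every KDISC-ODD row), `not_lineUnramifiedAt_of_pow_mul_eq_of_mult`,
  `not_lineUnramifiedAt_of_isIntegral_inv_of_mult`.

References: J.-P. Serre, Invent. Math. 15 (1972) §1.11–1.12 [SerreInventiones1972]; R. Greenberg,
V. Vatsal, Invent. Math. 142 (2000), Thm. (1.3), §2 pp. 14–15, p. 26 [GreenbergVatsal2000];
J. H. Silverman, *AEC*, GTM 106 (2009), VII.2.1, VII.3.1 [SilvermanAEC2009]; bsdN/HYPOTHESES.md row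
T-GV0; HOME/b2b-bsdres-lit-cgls/CGLS-GV-TYPING.md §22.
-/

set_option autoImplicit false

noncomputable section

open scoped Classical NumberField ComplexConjugate

open WeierstrassCurve Polynomial Literature.NumberTheory.EllipticCurves
  Literature.NumberTheory.EllipticCurves.Rank1Residual Literature.NumberTheory.GaloisRepresentations
  Field IsDedekindDomain NumberField Rat.HeightOneSpectrum

namespace Summit.BirchSwinnertonDyer.Rank1Residual

namespace KernelDisc

variable {W : WeierstrassCurve ℚ} [W.IsElliptic] [W.IsGloballyMinimal] {p : ℕ} [Fact p.Prime]
  {Φ : AddSubgroup (geomTorsion W (p : ℤ))}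
/-! ### §3. The criterion: unramified iff the abscissa is `𝔓`-integral (multiplicative odd `p`) -/

section Place

/-- **A rational `p`-line with one `𝔓`-integral non-zero point is UNRAMIFIED at a multiplicative odd
`p`.** For `E/ℚ` given by a globally minimal `W` with multiplicative reduction at the odd prime `p`,
a rational line `Φ ≤ E[p]` and `P = (x, y) ∈ Φ` with `v_𝔓(x) ≤ 1`: `Φ` is unramified at `p`.
Otherwise `Φ` would be the inertia line at the place's prime (`eq_of_not_lineUnramifiedAt` with §2's
Tate-free (hL)), all of whose non-zero points are off the integral locus (§2). The converse of
`X2.UnramifiedLineIntegral.valuation_le_one_of_lineUnramifiedAt_of_mult`.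
[cite: SerreInventiones1972, §1.11–1.12] [cite: SilvermanAEC2009, VII.2 Prop. 2.1] -/
theorem lineUnramifiedAt_of_valuation_le_one_of_mult (hΦ : IsRationalLine W p Φ) (hp2 : p ≠ 2)
    (hmult : W.HasMultiplicativeReductionAtPrime p)
    {P : geomTorsion W (p : ℤ)} (hPΦ : P ∈ Φ)
    {x y : AlgebraicClosure ℚ} {h : (W.baseChange (AlgebraicClosure ℚ)).toAffine.Nonsingular x y}
    (hP : (P : W.geomPoints) = Affine.Point.some x y h) (hx : (placeOver p).valuation x ≤ 1) :
    LineUnramifiedAt W p Φ := by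
  have hp : p.Prime := Fact.out
  set v := (primesEquiv (R := 𝓞 ℚ)).symm ⟨p, hp⟩ with hvdef
  have hvp : (primesEquiv v : ℕ) = p :=
    congrArg Subtype.val ((primesEquiv (R := 𝓞 ℚ)).apply_symm_apply ⟨p, hp⟩)
  have hv : (p : 𝓞 ℚ) ∈ v.asIdeal := natCast_mem_asIdeal_primesEquiv_symm
  obtain ⟨𝔓, hmem, h𝔓⟩ := exists_ideal_placeOver p hvp
  obtain ⟨X, hXcard, hXsub⟩ := W.exists_addSubgroup_card_le_of_hasMultiplicativeReductionAt hp2 hv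
    (hasMultiplicativeReductionAt_of_natCast_mem hmult hv) h𝔓
  obtain ⟨hXp, hXred, -⟩ :=
    card_eq_and_reducesToZero_and_exists_smul_ne_of_inertiaLine hp2 hmult hmem hXcard hXsub
  by_contra hr
  have hΦX : Φ = X := eq_of_not_lineUnramifiedAt hΦ hr hv h𝔓 hXp hXsub
  have hlt : 1 < (placeOver p).valuation x :=
    (reducesToZero_place_iff_of_eq_some hP).mp (hXred P (hΦX ▸ hPΦ))
  exact absurd hx (not_le.mpr hlt)

/-- **Unramified iff the abscissa is `𝔓`-integral — at a MULTIPLICATIVE odd `p`.** For `E/ℚ` given by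
a globally minimal `W` with multiplicative reduction at the odd prime `p`, a rational line `Φ ≤ E[p]`,
a non-zero `P = (x, y) ∈ Φ`, and the tree's place `𝔓` of `ℚ̄` over `p` (`placeOver p`): `Φ` is
UNRAMIFIED at `p` iff `v_𝔓(x) ≤ 1`; i.e. RAMIFIED iff `Φ` is the canonical subgroup (the inertia line)
iff `x ∉ 𝒪_𝔓` — T-GV0's "ramified ⇔ `H` not `p`-integral" at a multiplicative prime, the twin of the
good-ordinary `lineUnramifiedAt_iff_valuation_le_one`. Forward half: unit `eisenstein-p2`
(`X2.UnramifiedLineIntegral.valuation_le_one_of_lineUnramifiedAt_of_mult`). No Tate uniformisation.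
[cite: SerreInventiones1972, §1.11–1.12] [cite: SilvermanAEC2009, VII.2 Prop. 2.1] -/
theorem lineUnramifiedAt_iff_valuation_le_one_of_mult (hΦ : IsRationalLine W p Φ) (hp2 : p ≠ 2)
    (hmult : W.HasMultiplicativeReductionAtPrime p)
    {P : geomTorsion W (p : ℤ)} (hPΦ : P ∈ Φ)
    {x y : AlgebraicClosure ℚ} {h : (W.baseChange (AlgebraicClosure ℚ)).toAffine.Nonsingular x y}
    (hP : (P : W.geomPoints) = Affine.Point.some x y h) :
    LineUnramifiedAt W p Φ ↔ (placeOver p).valuation x ≤ 1 :=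
  ⟨fun hunr ↦ X2.UnramifiedLineIntegral.valuation_le_one_of_lineUnramifiedAt_of_mult hp2 hmult hunr
      hPΦ hP,
    lineUnramifiedAt_of_valuation_le_one_of_mult hΦ hp2 hmult hPΦ hP⟩

/-- **Ramified iff the abscissa is not `𝔓`-integral** (same data, multiplicative odd `p`).
[cite: SerreInventiones1972, §1.11–1.12] -/
theorem not_lineUnramifiedAt_iff_one_lt_valuation_of_mult (hΦ : IsRationalLine W p Φ) (hp2 : p ≠ 2)
    (hmult : W.HasMultiplicativeReductionAtPrime p)
    {P : geomTorsion W (p : ℤ)} (hPΦ : P ∈ Φ)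
    {x y : AlgebraicClosure ℚ} {h : (W.baseChange (AlgebraicClosure ℚ)).toAffine.Nonsingular x y}
    (hP : (P : W.geomPoints) = Affine.Point.some x y h) :
    ¬ LineUnramifiedAt W p Φ ↔ 1 < (placeOver p).valuation x := by
  rw [lineUnramifiedAt_iff_valuation_le_one_of_mult hΦ hp2 hmult hPΦ hP, not_le]

/-- **Ramified iff `Φ` is the inertia line**: at a multiplicative odd `p`, for a rational line `Φ` and
ANY prime `𝔓` of `\bar ℤ` above `p`, `Φ` is ramified at `p` iff `(σ - 1)E[p] ⊆ Φ` for every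
`σ ∈ I_𝔓` (iff `Φ` is the canonical subgroup `μ_p`-line of the Tate curve — here Tate-free, §2).
[cite: GreenbergVatsal2000, §2 pp. 14–15 and p. 26] [cite: SerreInventiones1972, §1.12] -/
theorem not_lineUnramifiedAt_iff_forall_smul_sub_mem_of_mult (hΦ : IsRationalLine W p Φ)
    (hp2 : p ≠ 2) (hmult : W.HasMultiplicativeReductionAtPrime p)
    {v : HeightOneSpectrum (𝓞 ℚ)} (hv : (p : 𝓞 ℚ) ∈ v.asIdeal)
    {𝔓 : Ideal (absIntegers (𝓞 ℚ) ℚ)} (h𝔓 : 𝔓 ∈ v.primesAbove) :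
    ¬ LineUnramifiedAt W p Φ ↔
      ∀ σ ∈ 𝔓.inertia (absoluteGaloisGroup ℚ), ∀ P : geomTorsion W (p : ℤ), σ • P - P ∈ Φ := by
  obtain ⟨L, hLcard, hLsub, σ₀, hσ₀, P₀, hP₀L, hne⟩ := exists_inertiaLine_of_mult W p hp2 hmult v hv 𝔓 h𝔓
  constructor
  · intro hr
    rw [eq_of_not_lineUnramifiedAt hΦ hr hv h𝔓 hLcard hLsub]
    exact hLsub
  · intro hsub hunr
    rcases line_eq_or_inf_eq_bot hΦ.1 hLcard with heq | hbot
    · exact hne ((lineUnramifiedAt_iff_forall_mem_inertia hΦ hv h𝔓).mp hunr σ₀ hσ₀ P₀ (heq ▸ hP₀L))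
    · have hmemΦL : σ₀ • P₀ - P₀ ∈ Φ ⊓ L := AddSubgroup.mem_inf.mpr ⟨hsub σ₀ hσ₀ P₀, hLsub σ₀ hσ₀ P₀⟩
      rw [hbot, AddSubgroup.mem_bot, sub_eq_zero] at hmemΦL
      exact hne hmemΦL

/-- **The inertia line at a multiplicative odd `p` is unique** (at each prime `𝔓` above `p`): two
subgroups `L, L' ≤ E[p]` of order `p` receiving `σP - P` for all `σ ∈ I_𝔓` coincide — the Tate-free
form of the uniqueness of the `μ_p`-line of the Tate curve (`X2.TateLineUnique`, there granted `hT'`).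
Proof: the line of `exists_inertiaLine_of_mult` carries a point moved by some `σ ∈ I_𝔓`; the non-zero
`σP - P` lies in all three lines. [cite: GreenbergVatsal2000, §2 pp. 14–16] [cite: SerreInventiones1972, §1.12] -/
theorem inertiaLine_eq_of_mult (hp2 : p ≠ 2) (hmult : W.HasMultiplicativeReductionAtPrime p)
    {v : HeightOneSpectrum (𝓞 ℚ)} (hv : (p : 𝓞 ℚ) ∈ v.asIdeal)
    {𝔓 : Ideal (absIntegers (𝓞 ℚ) ℚ)} (h𝔓 : 𝔓 ∈ v.primesAbove)
    {L L' : AddSubgroup (geomTorsion W (p : ℤ))} (hL : Nat.card L = p)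
    (hLsub : ∀ σ ∈ 𝔓.inertia (absoluteGaloisGroup ℚ), ∀ P : geomTorsion W (p : ℤ), σ • P - P ∈ L)
    (hL' : Nat.card L' = p)
    (hL'sub : ∀ σ ∈ 𝔓.inertia (absoluteGaloisGroup ℚ), ∀ P : geomTorsion W (p : ℤ), σ • P - P ∈ L') :
    L = L' := by
  obtain ⟨L₀, -, -, σ₀, hσ₀, P₀, -, hne⟩ := exists_inertiaLine_of_mult W p hp2 hmult v hv 𝔓 h𝔓
  have hne0 : σ₀ • P₀ - P₀ ≠ 0 := sub_ne_zero.mpr hne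
  rcases line_eq_or_inf_eq_bot hL hL' with heq | hbot
  · exact heq
  · have hmem : σ₀ • P₀ - P₀ ∈ L ⊓ L' := AddSubgroup.mem_inf.mpr ⟨hLsub σ₀ hσ₀ P₀, hL'sub σ₀ hσ₀ P₀⟩
    rw [hbot, AddSubgroup.mem_bot] at hmem
    exact absurd hmem hne0

/-- **Every non-zero point of a RAMIFIED rational line has non-integral abscissa; every non-zero point
of an UNRAMIFIED one is integral** — the criterion does not depend on the chosen point (multiplicative
odd `p`). Bookkeeping form of `lineUnramifiedAt_iff_valuation_le_one_of_mult` for two points.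
[cite: SerreInventiones1972, §1.11–1.12] -/
theorem valuation_le_one_iff_of_mem_of_mult (hΦ : IsRationalLine W p Φ) (hp2 : p ≠ 2)
    (hmult : W.HasMultiplicativeReductionAtPrime p)
    {P P' : geomTorsion W (p : ℤ)} (hPΦ : P ∈ Φ) (hP'Φ : P' ∈ Φ)
    {x y : AlgebraicClosure ℚ} {h : (W.baseChange (AlgebraicClosure ℚ)).toAffine.Nonsingular x y}
    (hP : (P : W.geomPoints) = Affine.Point.some x y h)
    {x' y' : AlgebraicClosure ℚ} {h' : (W.baseChange (AlgebraicClosure ℚ)).toAffine.Nonsingular x' y'}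
    (hP' : (P' : W.geomPoints) = Affine.Point.some x' y' h') :
    (placeOver p).valuation x ≤ 1 ↔ (placeOver p).valuation x' ≤ 1 := by
  rw [← lineUnramifiedAt_iff_valuation_le_one_of_mult hΦ hp2 hmult hPΦ hP,
    lineUnramifiedAt_iff_valuation_le_one_of_mult hΦ hp2 hmult hP'Φ hP']

/-! #### Certificate shapes (multiplicative odd `p`) -/

/-- **Unramified certificate** (multiplicative odd `p`): if `x · d` is integral over `ℤ` for an integer
`d` prime to `p` — e.g. `x` a root of a MONIC `p`-integral kernel polynomial, denominators cleared,
the shape of every KDISC-ODD row — then `Φ` is unramified at `p`. [folklore] -/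
theorem lineUnramifiedAt_of_isIntegral_of_mult (hΦ : IsRationalLine W p Φ) (hp2 : p ≠ 2)
    (hmult : W.HasMultiplicativeReductionAtPrime p)
    {P : geomTorsion W (p : ℤ)} (hPΦ : P ∈ Φ)
    {x y : AlgebraicClosure ℚ} {h : (W.baseChange (AlgebraicClosure ℚ)).toAffine.Nonsingular x y}
    (hP : (P : W.geomPoints) = Affine.Point.some x y h) {d : ℤ} (hd : ¬ (p : ℤ) ∣ d)
    (hint : IsIntegral ℤ (x * (d : AlgebraicClosure ℚ))) : LineUnramifiedAt W p Φ := by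
  refine lineUnramifiedAt_of_valuation_le_one_of_mult hΦ hp2 hmult hPΦ hP ?_
  have hle : (placeOver p).valuation (x * (d : AlgebraicClosure ℚ)) ≤ 1 :=
    (Valuation.mem_integer_iff _ _).mp
      ((integers_placeOver p).mem_of_integral (isIntegral_placeOver_of_isIntegral_int hint))
  rw [map_mul, valuation_placeOver_intCast_eq_one p hd, mul_one] at hle
  exact hle

/-- **Ramified certificate, power form** (multiplicative odd `p`): `x^k · p · s = d` with `s` integral
over `ℤ` and `d` an integer prime to `p` for the abscissa `x` of a non-zero point of the rational line
`Φ` ⇒ `v_𝔓(x) > 1` ⇒ `Φ` is ramified at `p` (canonical-subgroup abscissas at a multiplicative `p`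
have `|x|_𝔓 = |p|^{-2/(p-1)}`, so `k = p - 1` serves). [folklore] -/
theorem not_lineUnramifiedAt_of_pow_mul_eq_of_mult (hΦ : IsRationalLine W p Φ) (hp2 : p ≠ 2)
    (hmult : W.HasMultiplicativeReductionAtPrime p)
    {P : geomTorsion W (p : ℤ)} (hPΦ : P ∈ Φ)
    {x y : AlgebraicClosure ℚ} {h : (W.baseChange (AlgebraicClosure ℚ)).toAffine.Nonsingular x y}
    (hP : (P : W.geomPoints) = Affine.Point.some x y h) {s : AlgebraicClosure ℚ} {k : ℕ}
    (hs : IsIntegral ℤ s) {d : ℤ} (hd : ¬ (p : ℤ) ∣ d) (hx : x ^ k * ((p : AlgebraicClosure ℚ) * s) = d) :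
    ¬ LineUnramifiedAt W p Φ :=
  (not_lineUnramifiedAt_iff_one_lt_valuation_of_mult hΦ hp2 hmult hPΦ hP).mpr
    (one_lt_valuation_of_pow_mul_eq hs hd hx)

/-- **Ramified certificate, linear form** (multiplicative odd `p`; serves `p = 3`): `x · p · s = d` with
`s` integral over `ℤ`, `p ∤ d` ⇒ `Φ` is ramified at `p`. [folklore] -/
theorem not_lineUnramifiedAt_of_isIntegral_inv_of_mult (hΦ : IsRationalLine W p Φ) (hp2 : p ≠ 2)
    (hmult : W.HasMultiplicativeReductionAtPrime p)
    {P : geomTorsion W (p : ℤ)} (hPΦ : P ∈ Φ)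
    {x y : AlgebraicClosure ℚ} {h : (W.baseChange (AlgebraicClosure ℚ)).toAffine.Nonsingular x y}
    (hP : (P : W.geomPoints) = Affine.Point.some x y h) {s : AlgebraicClosure ℚ} (hs : IsIntegral ℤ s)
    {d : ℤ} (hd : ¬ (p : ℤ) ∣ d) (hx : x * ((p : AlgebraicClosure ℚ) * s) = d) :
    ¬ LineUnramifiedAt W p Φ :=
  not_lineUnramifiedAt_of_pow_mul_eq_of_mult hΦ hp2 hmult hPΦ hP (k := 1) hs hd (by rwa [pow_one])

end Place

end KernelDisc

end Summit.BirchSwinnertonDyer.Rank1Residual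

end
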